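import Mathlib.Data.Real.Basic
import Mathlib.Tactic

/-!
# PartN24 — one-hole Birman–Schwinger channels in closed form (memo ROTOR-THEORY-19 §254(a), THEOREMS M85)

Abstract algebraic layer.  For the torus resolvent `G = (L_G − λ)⁻¹` write `G0 = G(0)`, `G1 = G(e₁)`,
`G11 = G(e₁+e₂)`, `G20 = G(2e₁)`.  The resolvent equation `(L_G − λ)G = δ` read at `x = 0` and `x = e₁` gives
the two linear relations `h0`, `h1` below; from them the s-channel eigenvalue of the one-hole
Birman–Schwinger matrix `K = ½ G^ζ` (with the Schur term `G1²/G0`) collapses to `G1/G0 = 1 − λ/2 − 1/(2 G0)`,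
which is `< 1` as soon as `G0 > 0` and `λ > 0`; the p- and d-channels lose the Schur term identically.
`resolvent_zero_pos` is the positivity `G_{θε₁}(0) > 0` for `θ > 1/5` from the `k = 0` term, the quadruplet and
a nonnegative remainder.  Mathlib only.

PORT (prover seat `hubbard-h0-rotor-p1` g20): theory seat file `cycle19/lean/PartN24.lean` (sha16 c4d08cbe79df13a4) verbatim,
except the import line (narrowed from `import Mathlib`), `set_option linter.dupNamespace false` and one added docstring.  Helper
file for the S-bridge dossier of stmt-HubbardSuperconductivity-19089 (HYPOTHESIS G2 of memo 19, REPORT 20 add. 4); it closes no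
item.  No definition is introduced.
-/

set_option linter.dupNamespace false

namespace Summit.HubbardSuperconductivity.HubbardSuperconductivity.Theorems.AnisotropyChord.Transfer.OneHole

/-- s-channel: `½ (G0 + 2 G11 + G20 − 4 G1²/G0) = G1/G0` under the two resolvent relations. -/
theorem mu_s_eq (G0 G1 G11 G20 lam : ℝ) (hG0 : G0 ≠ 0)
    (h0 : 2 * G0 - 2 * G1 = 1 + lam * G0)
    (h1 : G20 + 2 * G11 = 4 * G1 - G0 - 2 * lam * G1) :
    (1 / 2 : ℝ) * (G0 + 2 * G11 + G20 - 4 * G1 ^ 2 / G0) = G1 / G0 := by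
  have h1' : 2 * G11 + G20 = 4 * G1 - G0 - 2 * lam * G1 := by linarith
  have : G0 + 2 * G11 + G20 - 4 * G1 ^ 2 / G0 = 2 * G1 / G0 := by
    rw [show G0 + 2 * G11 + G20 = 4 * G1 - 2 * lam * G1 by linarith]
    have h0' : (4 - 2 * lam) * G0 - 4 * G1 = 2 := by linarith
    field_simp
    linear_combination G1 * h0'
  rw [this]; ring

/-- s-channel value in terms of `G0` alone: `G1/G0 = 1 − λ/2 − 1/(2 G0)`. -/
theorem mu_s_closed (G0 G1 lam : ℝ) (hG0 : G0 ≠ 0) (h0 : 2 * G0 - 2 * G1 = 1 + lam * G0) :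
    G1 / G0 = 1 - lam / 2 - 1 / (2 * G0) := by
  have hG1 : G1 = G0 - 1 / 2 - lam * G0 / 2 := by linarith
  rw [hG1]; field_simp; ring

/-- If `G0 > 0` and `λ > 0` the s-channel eigenvalue is `< 1 − λ/2 < 1`. -/
theorem mu_s_lt (G0 G1 lam : ℝ) (hG0 : 0 < G0)
    (h0 : 2 * G0 - 2 * G1 = 1 + lam * G0) : G1 / G0 < 1 - lam / 2 := by
  rw [mu_s_closed G0 G1 lam hG0.ne' h0]
  have : 0 < 1 / (2 * G0) := by positivity
  linarith

/-- If `G0 > 0` and `λ > 0` the s-channel eigenvalue is `< 1`. -/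
theorem mu_s_lt_one (G0 G1 lam : ℝ) (hG0 : 0 < G0) (hlam : 0 < lam)
    (h0 : 2 * G0 - 2 * G1 = 1 + lam * G0) : G1 / G0 < 1 := by
  have := mu_s_lt G0 G1 lam hG0 h0; linarith

/-- p-channel: the Schur terms cancel, `½[(G0 − G1²/G0) − (G20 − G1²/G0)] = ½ (G0 − G20)`. -/
theorem mu_p_eq (G0 G1 G20 : ℝ) :
    (1 / 2 : ℝ) * ((G0 - G1 ^ 2 / G0) - (G20 - G1 ^ 2 / G0)) = (1 / 2) * (G0 - G20) := by ring

/-- d-channel: `½[(G0 − c) − 2 (G11 − c) + (G20 − c)] = ½ (G0 − 2 G11 + G20)` with `c = G1²/G0`. -/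
theorem mu_d_eq (G0 G1 G11 G20 : ℝ) :
    (1 / 2 : ℝ) * ((G0 - G1 ^ 2 / G0) - 2 * (G11 - G1 ^ 2 / G0) + (G20 - G1 ^ 2 / G0))
      = (1 / 2) * (G0 - 2 * G11 + G20) := by ring

/-- Positivity of `G_{θ ε₁}(0)`: `k = 0` term `−1/(V θ ε₁)`, quadruplet `4/(V (1−θ) ε₁)`, remainder `R ≥ 0`;
positive for every `θ ∈ (1/5, 1)`. -/
theorem resolvent_zero_pos (V eps1 th R : ℝ) (hV : 0 < V) (heps : 0 < eps1)
    (hth : 1 / 5 < th) (hth1 : th < 1) (hR : 0 ≤ R) :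
    0 < -1 / (V * (th * eps1)) + 4 / (V * ((1 - th) * eps1)) + R := by
  have h1 : 0 < V * (th * eps1) := by
    have : 0 < th := by linarith
    positivity
  have h2 : 0 < V * ((1 - th) * eps1) := by
    have : 0 < 1 - th := by linarith
    positivity
  have key : 1 / (V * (th * eps1)) < 4 / (V * ((1 - th) * eps1)) := by
    rw [div_lt_div_iff₀ h1 h2]
    have : 0 < V * eps1 := by positivity
    nlinarith
  have : -1 / (V * (th * eps1)) = -(1 / (V * (th * eps1))) := by ring
  linarith

end Summit.HubbardSuperconductivity.HubbardSuperconductivity.Theorems.AnisotropyChord.Transfer.OneHole
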